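import Mathlib
import HarnessLib
import Summits.CriticalPhenomena.PercolationContinuityZ3.Theses.PercLayerChain
import Summits.CriticalPhenomena.PercolationContinuityZ3.Theorems.PercLayerChainShadowTransport
import Summits.CriticalPhenomena.PercolationContinuityZ3.Theorems.PercLayerChainMomentGivesReciprocity
import Literature.Probability.Percolation.HalfSpacePinnedPairs

/-!
# `ShadowDensityVanishes` decomposed: subpolynomial section moments ∧ quantitative BGN
(route `PercLayerChain`, strategist split of the deciding crux `stmt-CriticalPhenomena-5747`)

Bond percolation on `ℤ³` at `p_c`, `H = {x | 0 ≤ x₀}`, `y_t = (t,0,0)`,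
`s_t = P(y_t ↔ ∂H in H)` (shadow density), `D_t = |C_H(0) ∩ {x₀ = t}|`, `W = |C_H(0) ∩ ∂H|`,
`π_t = P(C_H(0) meets {x₀ = t})`, `π_s(r) = P(C_H(0) reaches sup-distance ≥ r)`.

The deciding crux `ShadowDensityVanishes` (`s_t → 0`, equivalent to `θ(p_c) = 0`) is cut along
the reverse-Hölder seam of the shadow transport identity `s_t = E[(D_t/W)·𝟙{D_t ≥ 1}]` into two
pieces, neither of which bounds `s_t` on its own:

* `SectionMomentSubpolynomial` (**X₁**): for some `q > 1` the `q`-th section-ratio moment grows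
  subpolynomially, `E[(D_t/W)^q] ≤ C_b t^b` for every `b > 0` (the route's `SectionRatioMoment`
  asks for `b = 0`, under which the *qualitative* BGN theorem `π_t → 0` suffices; with any growth
  at all a RATE for `π_t` is needed);
* `QuantitativeBGN` (**X₂**, the shared crux `stmt-CriticalPhenomena-0913`, verbatim the decl of route
  `PercLowPointHalfSpace`): `π_s(r) ≤ C r^{-a}` for some `a > 0`.

**Assembly** (`shadowDensityVanishes_of_subs`, closing the glue item `SplitGlue` as `splitGlue_proof`):
with `b = a(q-1)/2`, Hölder
(`lintegral_ratio_le_holder`) and `π_t ≤ π_s(t)` give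
`s_t ≤ (C₁ t^b)^{1/q} (C₂ t^{-a})^{1-1/q} = K · t^{-a(q-1)/(2q)} → 0`.

Sources: R. Lyons – Y. Peres, *Probability on Trees and Networks* (2016), §8.2 (mass transport);
G. Grimmett, *Percolation* (1999), Thm. (7.35) (Barsky–Grimmett–Newman); Hölder (Mathlib).
-/

noncomputable section

namespace Summit.CriticalPhenomena.PercolationContinuityZ3.Cruxes.ShadowDensityVanishes.SplitAssembly

open MeasureTheory Filter Literature.Probability.Percolation Literature.Probability.LatticeModels
open scoped ENNReal Topology

namespace ShadowDensityVanishesSplit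

/-- **Per-level real Hölder bound.** If `∫ (D_t/W)^q dP ≤ A` and `π_t ≤ B` (`A, B ≥ 0`, `q > 1`)
then `s_t ≤ A^{1/q} · B^{1-1/q}`: the shadow transport identity `s_t = ∫ D_t/W dP`
(`shadowTransport_proof`) and Hölder (`lintegral_ratio_le_holder`), read in `ℝ`. [folklore] -/
theorem shadow_le_of_bounds {q : ℝ} (hq : 1 < q) (t : ℕ) {A B : ℝ} (hA : 0 ≤ A) (hB : 0 ≤ B)
    (hmom : ∫⁻ ω, ENNReal.ofReal
        ((({v : Site 3 | v 0 = (t : ℤ) ∧ ω ∈ openConnIn {x : Site 3 | 0 ≤ x 0} 0 v}.ncard : ℝ) /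
          ({v : Site 3 | v 0 = 0 ∧ ω ∈ openConnIn {x : Site 3 | 0 ≤ x 0} 0 v}.ncard : ℝ)) ^ q)
            ∂(bondPercolation (zdGraph 3) (criticalProbI 3)) ≤ ENNReal.ofReal A)
    (harm : (bondPercolation (zdGraph 3) (criticalProbI 3)).real
        {ω | ∃ y : Site 3, y 0 = (t : ℤ) ∧ ω ∈ openConnIn {x : Site 3 | 0 ≤ x 0} 0 y} ≤ B) :
    (bondPercolation (zdGraph 3) (criticalProbI 3)).real
        {ω | ∃ w : Site 3, w 0 = 0 ∧
          ω ∈ openConnIn {x : Site 3 | 0 ≤ x 0} (Pi.single 0 (t : ℤ)) w} ≤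
      A ^ (1 / q) * B ^ (1 - q⁻¹) := by
  have hq0 : 0 < q := lt_trans zero_lt_one hq
  have ha : 0 < 1 - q⁻¹ := by
    have : q⁻¹ < 1 := inv_lt_one_of_one_lt₀ hq
    linarith
  -- the shadow transport identity, in measure form
  have hT := Theorems.shadowTransport_proof t
  rw [ofReal_measureReal] at hT
  -- Hölder
  have h1 := Theorems.MomentGivesReciprocity.lintegral_ratio_le_holder (H := {x : Site 3 | 0 ≤ x 0})
    (bondPercolation (zdGraph 3) (criticalProbI 3)) (t : ℤ) hq
  rw [hT] at h1
  have h2 : (∫⁻ ω, ENNReal.ofReal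
        ((({v : Site 3 | v 0 = (t : ℤ) ∧ ω ∈ openConnIn {x : Site 3 | 0 ≤ x 0} 0 v}.ncard : ℝ) /
          ({v : Site 3 | v 0 = 0 ∧ ω ∈ openConnIn {x : Site 3 | 0 ≤ x 0} 0 v}.ncard : ℝ)) ^ q)
            ∂(bondPercolation (zdGraph 3) (criticalProbI 3))) ^ (1 / q) ≤
      (ENNReal.ofReal A) ^ (1 / q) :=
    ENNReal.rpow_le_rpow hmom (by positivity)
  have h3 : (bondPercolation (zdGraph 3) (criticalProbI 3)
        {ω' : BondConfig (Site 3) | ∃ y : Site 3, y 0 = (t : ℤ) ∧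
          ω' ∈ openConnIn {x : Site 3 | 0 ≤ x 0} 0 y}) ^ (1 - q⁻¹) ≤
      (ENNReal.ofReal B) ^ (1 - q⁻¹) := by
    refine ENNReal.rpow_le_rpow ?_ ha.le
    rw [← ofReal_measureReal]
    exact ENNReal.ofReal_le_ofReal harm
  have h4 := h1.trans (mul_le_mul' h2 h3)
  -- back to real numbers
  have hne : (ENNReal.ofReal A) ^ (1 / q) * (ENNReal.ofReal B) ^ (1 - q⁻¹) ≠ ⊤ :=
    ENNReal.mul_ne_top (ENNReal.rpow_ne_top_of_nonneg (by positivity) ENNReal.ofReal_ne_top)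
      (ENNReal.rpow_ne_top_of_nonneg ha.le ENNReal.ofReal_ne_top)
  have h5 := ENNReal.toReal_mono hne h4
  rw [ENNReal.toReal_mul, ← ENNReal.toReal_rpow, ← ENNReal.toReal_rpow, ENNReal.toReal_ofReal hA,
    ENNReal.toReal_ofReal hB] at h5
  rw [measureReal_def]
  exact h5

/-- The height-`t` arm is contained in the sup-distance-`t` arm: `{C_H(0) meets {x₀ = t}} ⊆
{C_H(0) reaches sup-distance ≥ t}`. [folklore] -/
theorem heightArm_subset_supArm (t : ℕ) :
    {ω : BondConfig (Site 3) | ∃ y : Site 3, y 0 = (t : ℤ) ∧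
        ω ∈ openConnIn {x : Site 3 | 0 ≤ x 0} 0 y} ⊆
      {ω | ∃ y : Site 3, (∃ i : Fin 3, (t : ℤ) ≤ |y i|) ∧
        ω ∈ openConnIn {x : Site 3 | 0 ≤ x 0} 0 y} := by
  rintro ω ⟨y, hy, hconn⟩
  refine ⟨y, ⟨0, ?_⟩, hconn⟩
  rw [hy]
  exact le_abs_self _

/-- Exponent bookkeeping: `(K₁ t^b)^{1/q} (K₂ t^{-a})^{1-1/q} = K₁^{1/q} K₂^{1-1/q} t^{-a(q-1)/(2q)}`
for `b = a(q-1)/2`, `t > 0`, `K₁, K₂ ≥ 0`. [folklore] -/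
theorem majorant_eq {q a K₁ K₂ t : ℝ} (hq : 1 < q) (hK₁ : 0 ≤ K₁) (hK₂ : 0 ≤ K₂) (ht : 0 < t) :
    (K₁ * t ^ (a * (q - 1) / 2)) ^ (1 / q) * (K₂ * t ^ (-a)) ^ (1 - q⁻¹) =
      K₁ ^ (1 / q) * K₂ ^ (1 - q⁻¹) * t ^ (-(a * (q - 1) / (2 * q))) := by
  have hq0 : q ≠ 0 := by positivity
  rw [Real.mul_rpow hK₁ (Real.rpow_nonneg ht.le _), Real.mul_rpow hK₂ (Real.rpow_nonneg ht.le _),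
    ← Real.rpow_mul ht.le, ← Real.rpow_mul ht.le]
  have hexp : a * (q - 1) / 2 * (1 / q) + -a * (1 - q⁻¹) = -(a * (q - 1) / (2 * q)) := by
    field_simp
    ring
  calc K₁ ^ (1 / q) * t ^ (a * (q - 1) / 2 * (1 / q)) * (K₂ ^ (1 - q⁻¹) * t ^ (-a * (1 - q⁻¹)))
      = K₁ ^ (1 / q) * K₂ ^ (1 - q⁻¹) *
          (t ^ (a * (q - 1) / 2 * (1 / q)) * t ^ (-a * (1 - q⁻¹))) := by ring
    _ = K₁ ^ (1 / q) * K₂ ^ (1 - q⁻¹) * t ^ (-(a * (q - 1) / (2 * q))) := by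
        rw [← Real.rpow_add ht, hexp]

end ShadowDensityVanishesSplit

open ShadowDensityVanishesSplit in
/-- **Strategist split of the deciding crux** `ShadowDensityVanishes` (item
`stmt-CriticalPhenomena-5747`) of route `PercLayerChain`:
`SectionMomentSubpolynomial → QuantitativeBGN → ShadowDensityVanishes`.
If for some `q > 1` the section-ratio moments `E_{p_c}[(D_t/W)^q]` grow subpolynomially in `t`
(`PercLayerChain.SectionMomentSubpolynomial`, item `stmt-CriticalPhenomena-17581`) and the boundary
one-arm probability at `p_c(ℤ³)` decays polynomially (`PercLayerChain.QuantitativeBGN`, the shared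
item `stmt-CriticalPhenomena-0913`), then
`s_t ≤ K t^{-a(q-1)/(2q)} → 0`: Hölder on the shadow transport identity with `b = a(q-1)/2`.
[folklore] -/
theorem shadowDensityVanishes_of_subs
    (h₁ : Theses.PercLayerChain.SectionMomentSubpolynomial)
    (h₂ : Theses.PercLayerChain.QuantitativeBGN) :
    Theses.PercLayerChain.ShadowDensityVanishes := by
  unfold Theses.PercLayerChain.ShadowDensityVanishes
  obtain ⟨q, hq, hmom⟩ := h₁
  obtain ⟨a, C₂, ha, harm⟩ := h₂
  have hq1 : 0 < q - 1 := by linarith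
  have hb0 : 0 < a * (q - 1) / 2 := by positivity
  obtain ⟨C₁, hC₁⟩ := hmom (a * (q - 1) / 2) hb0
  -- per-level bound with non-negative constants `K₁ = max C₁ 0`, `K₂ = max C₂ 0`
  have hbound : ∀ t : ℕ, 1 ≤ t →
      (bondPercolation (zdGraph 3) (criticalProbI 3)).real
          {ω | ∃ w : Site 3, w 0 = 0 ∧
            ω ∈ openConnIn {x : Site 3 | 0 ≤ x 0} (Pi.single 0 (t : ℤ)) w} ≤
        (max C₁ 0 * (t : ℝ) ^ (a * (q - 1) / 2)) ^ (1 / q) *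
          (max C₂ 0 * (t : ℝ) ^ (-a)) ^ (1 - q⁻¹) := by
    intro t ht
    refine shadow_le_of_bounds hq t (by positivity) (by positivity) ?_ ?_
    · exact (hC₁ t ht).trans (ENNReal.ofReal_le_ofReal
        (mul_le_mul_of_nonneg_right (le_max_left _ _) (by positivity)))
    · calc (bondPercolation (zdGraph 3) (criticalProbI 3)).real
            {ω | ∃ y : Site 3, y 0 = (t : ℤ) ∧ ω ∈ openConnIn {x : Site 3 | 0 ≤ x 0} 0 y}
          ≤ (bondPercolation (zdGraph 3) (criticalProbI 3)).real
              {ω | ∃ y : Site 3, (∃ i : Fin 3, (t : ℤ) ≤ |y i|) ∧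
                ω ∈ openConnIn {x : Site 3 | 0 ≤ x 0} 0 y} :=
            measureReal_mono (heightArm_subset_supArm t) (measure_ne_top _ _)
        _ ≤ C₂ * (t : ℝ) ^ (-a) := harm t ht
        _ ≤ max C₂ 0 * (t : ℝ) ^ (-a) :=
            mul_le_mul_of_nonneg_right (le_max_left _ _) (by positivity)
  -- the majorant is `K t^{-δ}` with `δ = a(q-1)/(2q) > 0`, hence tends to `0`
  have hδ : 0 < a * (q - 1) / (2 * q) := by positivity
  have hlim : Tendsto (fun t : ℕ => (max C₁ 0) ^ (1 / q) * (max C₂ 0) ^ (1 - q⁻¹) *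
      (t : ℝ) ^ (-(a * (q - 1) / (2 * q)))) atTop (𝓝 0) := by
    have h := (tendsto_rpow_neg_atTop hδ).comp tendsto_natCast_atTop_atTop
    have h' := h.const_mul ((max C₁ 0) ^ (1 / q) * (max C₂ 0) ^ (1 - q⁻¹))
    rw [mul_zero] at h'
    exact h'
  refine squeeze_zero' (Eventually.of_forall fun t => measureReal_nonneg) ?_ hlim
  filter_upwards [eventually_ge_atTop 1] with t ht
  have ht0 : (0 : ℝ) < (t : ℝ) := by exact_mod_cast ht
  rw [← majorant_eq hq (le_max_right _ _) (le_max_right _ _) ht0]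
  exact hbound t ht

/-- **`SplitGlue`** (item `stmt-CriticalPhenomena-17629`, exact signature of the route decl):
`SectionMomentSubpolynomial → QuantitativeBGN → ShadowDensityVanishes`. [folklore] -/
theorem splitGlue_proof : Theses.PercLayerChain.SplitGlue :=
  fun h₁ h₂ => shadowDensityVanishes_of_subs h₁ h₂

end Summit.CriticalPhenomena.PercolationContinuityZ3.Cruxes.ShadowDensityVanishes.SplitAssembly

end
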